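import Literature.NumberTheory.LFunctions.ZetaCertifiedEvaluation
import HarnessLib

/-!
# Kernel-evaluable variant of the certified multi-precision evaluator of `ζ(s)`

Trunk T-ANT (NumberTheory/LFunctions) with T-VALNUM. The certified evaluator
`Literature.NumberTheory.LFunctions.ZetaNumerics.zetaBox` of `ZetaCertifiedEvaluation.lean`
(Euler–Maclaurin of arbitrary order in the multi-precision interval arithmetic of
`Literature/Analysis/ValidatedNumerics/MultiPrecisionInterval.lean`, soundness `mem_zetaBox`) was
written for `native_decide`: two of its ingredients do not reduce in the kernel, because they are
defined by well-founded recursion —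

* `Nat.log 2 n` inside `MI.logNat` (the logarithm table of `mkTables`), and
* `Nat.minFac` inside `powEntry` (the multiplicative power table `powTable`).

This file gives drop-in variants that `decide +kernel` evaluates, with the *same* soundness
statements, so that certificates needing many digits of `ζ` at moderate height (beyond the reach
of the order-two evaluator `Literature.NumberTheory.LFunctions.ZetaCert.Node.zetaBox` of
`ZetaArgumentCertificate.lean`) can be checked by the kernel alone, with no compiler axiom:

* `logNatK` — `MI.logNat` with the kernel-accelerated `Nat.log2` (`logNatK_eq : logNatK = MI.logNat`
  by `Nat.log2_eq_log_two`); `mkLogsK`, `mkTablesK` and `mkTablesK_eq : mkTablesK = mkTables`, whence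
  `mkTablesK_valid`.
* `powTableK` — the table `[junk, 1^{-s}, …, N^{-s}]` with *every* entry evaluated afresh by
  `cpowFresh` (no factorisation; `N` instead of `π(N)` exponentials, harmless for `N ≲ 100`),
  `powTableK_spec`.
* `zetaBoxK` — `zetaBox` with `powTableK`, and **`mem_zetaBoxK`**:
  `T.Valid → s ∈ sB → s ≠ 1 → zetaBoxK T sB = some Z → ζ(s) ∈ Z` (the main part, the correction
  terms and the remainder radius are those of `ZetaCertifiedEvaluation.lean`, whose soundness lemmas
  `mem_mainBox`, `mem_termsBox`, `norm_emRem_mul_le_remRadius` are reused verbatim).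

Measured (Lean `v4.32.0` kernel, `decide +kernel`): tables at scale `2^80` with `N = 64`, `ν = 14`
(logarithms by `95` series terms at `2^90`, `π` by Machin) and one evaluation of `ζ(½ + 111.03 i)`
to radius `≈ 3·10⁻¹⁴` take about five seconds together. First consumer:
`Literature/Barriers/RiemannHypothesis/DeBrangesPositivityProofs.lean` (Conrey–Li's value at the
34th zero).

## References

* H. M. Edwards, *Riemann's Zeta Function* (1974), §6.4 (Euler–Maclaurin for `ζ`). [Edwards1974]
* R. E. Moore, *Interval Analysis*, Prentice-Hall 1966 (inclusion property). [folklore]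
-/

open Finset Complex
open Literature.Analysis.ValidatedNumerics.NumericsMP Literature.NumberTheory.LFunctions

namespace Literature.NumberTheory.LFunctions.ZetaNumerics

/-! ## Tables with `Nat.log2` -/

/-- `MI.logNat` with the binary exponent computed by `Nat.log2` (kernel-accelerated) instead of
`Nat.log 2` (well-founded recursion): for `n ≥ 1`, with `2^k ≤ n < 2^{k+1}`,
`log n = k log 2 - log (1 - (n - 2^k)/n)`. [folklore] -/
def logNatK (S K : ℕ) (n : ℕ) : Option MI :=
  if n = 0 then none else
    let k := Nat.log2 n
    match MI.logTwo S K, MI.logOneSub S K (MI.ofFrac S ((n : ℤ) - (2 : ℤ) ^ k) n) with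
    | some L2, some Y => some ((L2.mulInt k).sub Y)
    | _, _ => none

/-- `logNatK` is `MI.logNat`. [folklore] -/
theorem logNatK_eq (S K n : ℕ) : logNatK S K n = MI.logNat S K n := by
  simp only [logNatK, MI.logNat, Nat.log2_eq_log_two]
  rfl

/-- The `log` table `[junk, log 1, …, log N]` at scale `S` from evaluations at the finer scale `S'`
(as `mkLogs`, with `logNatK`). [folklore] -/
def mkLogsK (S S' Klog : ℕ) : ℕ → Option (Array MI)
  | 0 => some #[default]
  | n + 1 =>
    match mkLogsK S S' Klog n, logNatK S' Klog (n + 1) with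
    | some A, some L => some (A.push (MI.rescale S' S L))
    | _, _ => none

/-- `mkLogsK` is `mkLogs`. [folklore] -/
theorem mkLogsK_eq (S S' Klog : ℕ) : ∀ n, mkLogsK S S' Klog n = mkLogs S S' Klog n
  | 0 => rfl
  | n + 1 => by
    simp only [mkLogsK, mkLogs, mkLogsK_eq S S' Klog n, logNatK_eq]
    rfl

/-- Build tables (as `mkTables`, with `mkLogsK`): `π` and the logarithms are computed at scale
`S · 2^guard` and rounded to `S`. [folklore] -/
def mkTablesK (S N nu guard Klog Kpi Kexp kexp KI kI : ℕ) : Option Tables :=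
  let S' := S * 2 ^ guard
  if 0 < S ∧ 2 ≤ N ∧ nu ≠ 0 then
    match MI.pi S' Kpi, mkLogsK S S' Klog N, emRatios nu with
    | some P, some A, some R =>
        some ⟨S, N, nu, MI.rescale S' S P, A, R, Kexp, kexp, KI, kI⟩
    | _, _, _ => none
  else none

/-- `mkTablesK` is `mkTables`. [folklore] -/
theorem mkTablesK_eq (S N nu guard Klog Kpi Kexp kexp KI kI : ℕ) :
    mkTablesK S N nu guard Klog Kpi Kexp kexp KI kI = mkTables S N nu guard Klog Kpi Kexp kexp KI kI := by
  simp only [mkTablesK, mkTables, mkLogsK_eq]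
  rfl

/-- Tables built by `mkTablesK` are valid. [folklore] -/
theorem mkTablesK_valid {S N nu guard Klog Kpi Kexp kexp KI kI : ℕ} {T : Tables}
    (h : mkTablesK S N nu guard Klog Kpi Kexp kexp KI kI = some T) : T.Valid := by
  rw [mkTablesK_eq] at h
  exact mkTables_valid h

/-- `mkTablesK` records the scale it is given. [folklore] -/
theorem mkTablesK_S {S N nu guard Klog Kpi Kexp kexp KI kI : ℕ} {T : Tables}
    (h : mkTablesK S N nu guard Klog Kpi Kexp kexp KI kI = some T) : T.S = S := by
  unfold mkTablesK at h
  simp only at h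
  split_ifs at h
  split at h
  · simp only [Option.some.injEq] at h
    subst h
    rfl
  · simp at h

/-- `mkTablesK` records the truncation point it is given. [folklore] -/
theorem mkTablesK_N {S N nu guard Klog Kpi Kexp kexp KI kI : ℕ} {T : Tables}
    (h : mkTablesK S N nu guard Klog Kpi Kexp kexp KI kI = some T) : T.N = N := by
  unfold mkTablesK at h
  simp only at h
  split_ifs at h
  split at h
  · simp only [Option.some.injEq] at h
    subst h
    rfl
  · simp at h

/-! ## The power table, every entry afresh -/

/-- The table `[junk, 1^{-s}, 2^{-s}, …, m^{-s}]` of enclosures, each entry evaluated afresh by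
`cpowFresh` (`e^{-σ log n} · e^{-i t log n}` from the tables; no use of `Nat.minFac`).
[folklore] -/
def powTableK (T : Tables) (sB : MC) : ℕ → Option (Array MC)
  | 0 => some #[MC.ofInt T.S 0]
  | m + 1 =>
    match powTableK T sB m with
    | none => none
    | some A =>
      match cpowFresh T sB (m + 1) with
      | none => none
      | some b => some (A.push b)

/-- Soundness of `powTableK`: size `m + 1` and `n^{-s} ∈ A[n]` for `1 ≤ n ≤ m`. [folklore] -/
theorem powTableK_spec {T : Tables} (hT : T.Valid) {s : ℂ} {sB : MC} (hs : MC.mem T.S s sB) :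
    ∀ (m : ℕ) {A : Array MC}, m ≤ T.N → powTableK T sB m = some A →
      A.size = m + 1 ∧ ∀ n : ℕ, 1 ≤ n → n ≤ m → MC.mem T.S ((n : ℂ) ^ (-s)) (A.getD n default)
  | 0, A, _, h => by
    simp only [powTableK, Option.some.injEq] at h
    subst h
    exact ⟨rfl, fun n h1 h2 ↦ by omega⟩
  | m + 1, A, hm, h => by
    simp only [powTableK] at h
    split at h
    · simp at h
    · rename_i A0 hA0
      split at h
      · simp at h
      · rename_i b hb
        simp only [Option.some.injEq] at h
        subst h
        obtain ⟨hsz, hmem⟩ := powTableK_spec hT hs m (by omega) hA0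
        refine ⟨by simp [hsz], fun n h1 h2 ↦ ?_⟩
        rcases Nat.lt_succ_iff_lt_or_eq.1 (Nat.lt_succ_of_le h2) with hlt | heq
        · have hlt' : n < A0.size := by rw [hsz]; omega
          have := hmem n h1 (Nat.lt_succ_iff.1 hlt)
          rw [Array.getD_eq_getD_getElem?, Array.getElem?_push_lt hlt', Option.getD_some]
          rw [Array.getD_eq_getD_getElem?, getElem?_pos A0 n hlt', Option.getD_some] at this
          exact this
        · subst heq
          have hidx : (A0.push b)[m + 1]? = some b := by
            rw [← hsz]; exact Array.getElem?_push_size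
          rw [Array.getD_eq_getD_getElem?, hidx, Option.getD_some]
          exact mem_cpowFresh hT hs h1 hm hb

/-! ## The evaluator -/

/-- **The kernel-evaluable certified evaluator**: a box containing `ζ(s)` for all `s` in `sB`
(requires `0 < lo (re sB)`; soundness `mem_zetaBoxK` additionally needs `s ≠ 1`). Identical to
`zetaBox` except for the power table. [folklore] -/
def zetaBoxK (T : Tables) (sB : MC) : Option MC :=
  if 0 < sB.re.lo then
    match powTableK T sB T.N with
    | none => none
    | some A =>
      match mainBox T sB A with
      | none => none
      | some M => some ((M.add (termsBox T sB A)).widen (remRadius T sB))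
  else none

/-- **Soundness of the kernel-evaluable evaluator**: `ζ(s) ∈ zetaBoxK T sB` for every `s ∈ sB`,
`s ≠ 1`, valid `T`. [cite: Edwards1974, §6.4] -/
theorem mem_zetaBoxK {T : Tables} (hT : T.Valid) {s : ℂ} {sB : MC} (hs : MC.mem T.S s sB)
    (hs1 : s ≠ 1) {Z : MC} (h : zetaBoxK T sB = some Z) : MC.mem T.S (riemannZeta s) Z := by
  unfold zetaBoxK at h
  split_ifs at h with hlo
  split at h
  · simp at h
  · rename_i A hA
    split at h
    · simp at h
    · rename_i M hM
      simp only [Option.some.injEq] at h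
      subst h
      have hσ : 0 < s.re := MI.pos_of_lo_pos hs.1 hlo
      have hN1 : 1 ≤ T.N := le_trans (by norm_num) hT.two_le_N
      obtain ⟨-, hApow⟩ := powTableK_spec hT hs T.N le_rfl hA
      have hmain := mem_mainBox hT hs hApow hM
      have hterms := mem_termsBox hT hs hApow
      have hsum := MC.mem_add hmain hterms
      rw [riemannZeta_eq_eulerMaclaurin_of_re_pos hN1 hσ hs1 T.nu]
      apply MC.mem_widen hsum
      rw [show emMainZero T.N s + ∑ k ∈ Finset.Icc 1 T.nu, emTerm T.N s k + emRemHigher T.N T.nu s -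
        (emMainZero T.N s + ∑ j ∈ Finset.Icc 1 T.nu, emTerm T.N s j) = emRemHigher T.N T.nu s by ring]
      exact norm_emRem_mul_le_remRadius hT hs hσ

end Literature.NumberTheory.LFunctions.ZetaNumerics
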